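import Mathlib.Data.Matrix.Basic
import Mathlib.Algebra.Field.ZMod
import Mathlib.Data.Fintype.BigOperators
import Mathlib.Algebra.Order.BigOperators.Group.Finset
import Mathlib.Algebra.BigOperators.Ring.Finset
import Mathlib.Tactic.Linarith
import Mathlib.Tactic.Positivity
import Mathlib.Tactic.Ring
import Summits.PneNP.PneNP.Theorems.PermanentDescentCollapseMakesPermanentEasyIslandDefs
import HarnessLib

/-!
# Route PermanentDescent, crux `CollapseMakesPermanentEasy` (stmt-PneNP-16142), line `Sketch` — `stub_hitting`

Registered stub `stub_hitting` of the skeleton `Cruxes/CollapseMakesPermanentEasy/Lines/Sketch.lean`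
(idea `errorless-islands`): the HITTING DIRECTIONS of the erasure random self-reduction of the
permanent, made non-uniform. If `S ⊆ 𝔽_p^{n×n}` has density `≥ 4(n+1)/p` (`4(n+1)·p^{n·n} ≤ p·#S`)
then there is a list of `≤ p²n²` advice directions `D` such that through EVERY matrix `M` some
listed line `c ↦ M + c•D` meets `S` in at least `n + 1` nonzero parameters `c`.

Proof (pure finite counting; no probability library, no reals).
* Averaging (`sum_card_line_eq`): for fixed `M`, `∑_D #{c ≠ 0 | M + c•D ∈ S} = (p-1)·#S`, because
  for `c ≠ 0` the map `D ↦ M + c•D` is a bijection of the matrix space (`card_filter_line_eq`).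
* Reverse Markov (`card_lt_threshold_le`, bookkeeping `averaging_arith`): each term is `≤ p - 1`,
  and `≤ n` on the BAD directions (those below the threshold `n + 1`); with the density hypothesis
  this gives `p · #bad(M) ≤ (p-1) · p^{n·n}` for every `M`.
* Repetition + union bound (`exists_tuple_hitting`): among the `(p^{n·n})^m` tuples of `m = p²n²`
  directions, those bad for a fixed `M` in every coordinate number `#bad(M)^m`, so
  `p^m · #(tuples bad for some M) ≤ p^{n·n} · ((p-1)·p^{n·n})^m < p^m · (p^{n·n})^m` by the numeric
  fact `p^{n·n}·(p-1)^{p²n²} < p^{p²n²}` (`key_numeric`, from `2(p-1)^p ≤ p^p` and `p < 2^p`);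
  hence some tuple has, for every `M`, a coordinate outside `bad(M)`.
The hypothesis `n ^ 3 < p` of the registered signature is not needed and not used.
-/

set_option linter.dupNamespace false

namespace Summit.PneNP.PneNP.Theorems.PermIsland

/-! ## Numeric facts -/

/-- Two terms of the binomial expansion: `a^{j+1} + (j+1)·a^j ≤ (a+1)^{j+1}`. [folklore] -/
private theorem pow_add_mul_pow_le (a : ℕ) :
    ∀ j : ℕ, a ^ (j + 1) + (j + 1) * a ^ j ≤ (a + 1) ^ (j + 1)
  | 0 => by simp
  | j + 1 => by
    have ih := pow_add_mul_pow_le a j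
    calc a ^ (j + 1 + 1) + (j + 1 + 1) * a ^ (j + 1)
        ≤ (a ^ (j + 1) + (j + 1) * a ^ j) * (a + 1) := by
          rw [pow_succ, pow_succ]
          nlinarith [Nat.zero_le (a ^ j), Nat.zero_le a, Nat.zero_le ((j + 1) * a ^ j)]
      _ ≤ (a + 1) ^ (j + 1) * (a + 1) := Nat.mul_le_mul_right _ ih
      _ = (a + 1) ^ (j + 1 + 1) := (pow_succ _ _).symm

/-- `2·q^{q+1} ≤ (q+1)^{q+1}`, i.e. `(1 - 1/p)^p ≤ 1/2` for `p = q + 1`. [folklore] -/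
private theorem two_mul_pow_le (q : ℕ) : 2 * q ^ (q + 1) ≤ (q + 1) ^ (q + 1) := by
  have h := pow_add_mul_pow_le q q
  have h2 : q ^ (q + 1) ≤ (q + 1) * q ^ q := by
    rw [pow_succ]
    nlinarith [Nat.zero_le (q ^ q)]
  omega

/-- The numeric fact of the union bound: `p^{n·n} · (p-1)^{p²n²} < p^{p²n²}` for `p ≥ 2`, `n ≥ 1`
(from `2(p-1)^p ≤ p^p` and `p^{n·n} < 2^{p·n·n}`). [folklore] -/
private theorem key_numeric {p n : ℕ} (hp : 2 ≤ p) (hn : 0 < n) :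
    p ^ (n * n) * (p - 1) ^ (p ^ 2 * n ^ 2) < p ^ (p ^ 2 * n ^ 2) := by
  obtain ⟨q, rfl⟩ : ∃ q, p = q + 1 := ⟨p - 1, by omega⟩
  have hq : 0 < q := by omega
  rw [Nat.add_sub_cancel]
  have hm : (q + 1) ^ 2 * n ^ 2 = (q + 1) * ((q + 1) * (n * n)) := by ring
  rw [hm, pow_mul q (q + 1), pow_mul (q + 1) (q + 1)]
  have h1 : (q + 1) ^ (n * n) < 2 ^ ((q + 1) * (n * n)) := by
    rw [pow_mul (2 : ℕ) (q + 1) (n * n)]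
    exact Nat.pow_lt_pow_left Nat.lt_two_pow_self (Nat.mul_pos hn hn).ne'
  have h2 : 2 ^ ((q + 1) * (n * n)) * (q ^ (q + 1)) ^ ((q + 1) * (n * n)) ≤
      ((q + 1) ^ (q + 1)) ^ ((q + 1) * (n * n)) := by
    rw [← mul_pow]
    exact Nat.pow_le_pow_left (two_mul_pow_le q) _
  have h3 : 0 < (q ^ (q + 1)) ^ ((q + 1) * (n * n)) := pow_pos (pow_pos hq _) _
  calc (q + 1) ^ (n * n) * (q ^ (q + 1)) ^ ((q + 1) * (n * n))
      < 2 ^ ((q + 1) * (n * n)) * (q ^ (q + 1)) ^ ((q + 1) * (n * n)) :=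
        Nat.mul_lt_mul_of_pos_right h1 h3
    _ ≤ ((q + 1) ^ (q + 1)) ^ ((q + 1) * (n * n)) := h2

/-- The linear bookkeeping of the averaging step: from `(p-1)·s ≤ (p-1)·g + n·b` and
`4(n+1)(g+b) ≤ p·s` conclude `p·b ≤ (p-1)(g+b)`. [folklore] -/
private theorem averaging_arith {p n g b s : ℕ} (hp : 2 ≤ p)
    (hsum : (p - 1) * s ≤ g * (p - 1) + b * n) (hS : 4 * (n + 1) * (g + b) ≤ p * s) :
    p * b ≤ (p - 1) * (g + b) := by
  obtain ⟨q, rfl⟩ : ∃ q, p = q + 1 := ⟨p - 1, by omega⟩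
  rw [Nat.add_sub_cancel] at hsum ⊢
  have h2s : (q + 1) * s ≤ 2 * q * s := Nat.mul_le_mul_right s (by omega)
  nlinarith [hsum, hS, h2s, Nat.zero_le (n * b), Nat.zero_le (n * g), Nat.zero_le (q * g)]

/-! ## Counting lemmas -/

/-- Reverse Markov for the averaging step: if `X : V → ℕ` has `∑ X = (p-1)·s`, `X ≤ p - 1`
pointwise and `4(n+1)·#V ≤ p·s`, then the points of `V` below the threshold `n + 1` form at most
a `(1 - 1/p)` fraction of `V`. [folklore] -/
private theorem card_lt_threshold_le {V : Type*} [Fintype V] {p n s : ℕ} (hp : 2 ≤ p)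
    (X : V → ℕ) (hsum : ∑ D, X D = (p - 1) * s) (hle : ∀ D, X D ≤ p - 1)
    (hS : 4 * (n + 1) * Fintype.card V ≤ p * s) :
    p * (Finset.univ.filter fun D => ¬n + 1 ≤ X D).card ≤ (p - 1) * Fintype.card V := by
  have hsplit := Finset.card_filter_add_card_filter_not (s := (Finset.univ : Finset V))
    (fun D => n + 1 ≤ X D)
  rw [Finset.card_univ] at hsplit
  have h1 : ∑ D ∈ Finset.univ.filter (fun D => n + 1 ≤ X D), X D ≤
      (Finset.univ.filter fun D => n + 1 ≤ X D).card * (p - 1) :=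
    (Finset.sum_le_card_nsmul (Finset.univ.filter fun D => n + 1 ≤ X D) X (p - 1)
      fun D _ => hle D).trans (by rw [smul_eq_mul])
  have h2 : ∑ D ∈ Finset.univ.filter (fun D => ¬n + 1 ≤ X D), X D ≤
      (Finset.univ.filter fun D => ¬n + 1 ≤ X D).card * n :=
    (Finset.sum_le_card_nsmul (Finset.univ.filter fun D => ¬n + 1 ≤ X D) X n fun D hD => by
      have := (Finset.mem_filter.1 hD).2
      omega).trans (by rw [smul_eq_mul])
  have hsum' : (p - 1) * s ≤ (Finset.univ.filter fun D => n + 1 ≤ X D).card * (p - 1) +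
      (Finset.univ.filter fun D => ¬n + 1 ≤ X D).card * n := by
    rw [← hsum, ← Finset.sum_filter_add_sum_filter_not Finset.univ (fun D => n + 1 ≤ X D) X]
    exact add_le_add h1 h2
  rw [← hsplit] at hS ⊢
  exact averaging_arith hp hsum' hS

/-- Independent repetition + union bound: if every `bad M` has density `≤ 1 - 1/p` in `V` and
`#V · (p-1)^m < p^m`, then some `m`-tuple of points of `V` has, for every `M`, a coordinate outside
`bad M` (the tuples lying in `bad M` coordinatewise number `#(bad M)^m`; sum over `M`). [folklore] -/
private theorem exists_tuple_hitting {V : Type*} [Fintype V] [DecidableEq V] [Nonempty V]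
    {p m : ℕ} (bad : V → Finset V) (hbad : ∀ M, p * (bad M).card ≤ (p - 1) * Fintype.card V)
    (hnum : Fintype.card V * (p - 1) ^ m < p ^ m) :
    ∃ t : Fin m → V, ∀ M, ∃ i, t i ∉ bad M := by
  by_contra hcon
  have hcov : (Finset.univ : Finset (Fin m → V)) ⊆
      Finset.univ.biUnion fun M => Fintype.piFinset fun _ : Fin m => bad M := by
    intro t _
    rw [Finset.mem_biUnion]
    by_contra ht
    refine hcon ⟨t, fun M => ?_⟩
    by_contra hM
    refine ht ⟨M, Finset.mem_univ _, Fintype.mem_piFinset.2 fun i => ?_⟩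
    by_contra hi
    exact hM ⟨i, hi⟩
  have hcard := (Finset.card_le_card hcov).trans Finset.card_biUnion_le
  rw [Finset.card_univ, Fintype.card_pi_const] at hcard
  simp only [Fintype.card_piFinset_const] at hcard
  have h1 : p ^ m * Fintype.card V ^ m ≤ Fintype.card V * ((p - 1) * Fintype.card V) ^ m :=
    calc p ^ m * Fintype.card V ^ m
        ≤ p ^ m * ∑ M, (bad M).card ^ m := Nat.mul_le_mul_left _ hcard
      _ = ∑ M, (p * (bad M).card) ^ m := by
          rw [Finset.mul_sum]
          simp only [mul_pow]
      _ ≤ ∑ _M : V, ((p - 1) * Fintype.card V) ^ m :=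
          Finset.sum_le_sum fun M _ => Nat.pow_le_pow_left (hbad M) m
      _ = Fintype.card V * ((p - 1) * Fintype.card V) ^ m := by
          rw [Finset.sum_const, Finset.card_univ, smul_eq_mul]
  have h3 : Fintype.card V * ((p - 1) * Fintype.card V) ^ m < p ^ m * Fintype.card V ^ m := by
    rw [mul_pow, ← mul_assoc]
    exact Nat.mul_lt_mul_of_pos_right hnum (pow_pos Fintype.card_pos _)
  exact absurd (h1.trans_lt h3) (lt_irrefl _)

/-! ## The matrix space over `ZMod p` -/

/-- The number of `n × n` matrices over `ZMod p` is `p ^ (n·n)`. [folklore] -/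
private theorem card_matrix (p n : ℕ) [Fact p.Prime] :
    Fintype.card (Matrix (Fin n) (Fin n) (ZMod p)) = p ^ (n * n) :=
  calc Fintype.card (Matrix (Fin n) (Fin n) (ZMod p)) = Fintype.card (Fin n → Fin n → ZMod p) := rfl
    _ = p ^ (n * n) := by
        rw [Fintype.card_pi_const, Fintype.card_pi_const, ZMod.card, ← pow_mul]

/-- `ZMod p` has `p - 1` nonzero elements. [folklore] -/
private theorem card_univ_filter_ne_zero (p : ℕ) [Fact p.Prime] :
    (Finset.univ.filter fun c : ZMod p => c ≠ 0).card = p - 1 := by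
  rw [Finset.filter_ne', Finset.card_erase_of_mem (Finset.mem_univ _), Finset.card_univ, ZMod.card]

/-- For `c ≠ 0` the map `D ↦ M + c • D` is a bijection of the matrix space (inverse
`E ↦ c⁻¹ • (E - M)`), so the directions `D` with `M + c • D ∈ S` are as many as the points of `S`.
[folklore] -/
private theorem card_filter_line_eq (p n : ℕ) [Fact p.Prime]
    (S : Finset (Matrix (Fin n) (Fin n) (ZMod p))) (M : Matrix (Fin n) (Fin n) (ZMod p))
    {c : ZMod p} (hc : c ≠ 0) :
    (Finset.univ.filter fun D : Matrix (Fin n) (Fin n) (ZMod p) => M + c • D ∈ S).card = S.card := by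
  refine Finset.card_nbij' (fun D => M + c • D) (fun E => c⁻¹ • (E - M)) ?_ ?_ ?_ ?_
  · intro D hD
    simpa using hD
  · intro E hE
    have hE' : E ∈ S := by simpa using hE
    simp [hc, hE']
  · intro D _
    simp [hc]
  · intro E _
    simp [hc]

/-- Averaging identity: summing over all directions `D` the number of nonzero parameters `c` with
`M + c • D ∈ S` counts every pair `(c, E)` with `c ≠ 0`, `E ∈ S` exactly once, so the total is
`(p - 1) · #S`. [folklore] -/
private theorem sum_card_line_eq (p n : ℕ) [Fact p.Prime]
    (S : Finset (Matrix (Fin n) (Fin n) (ZMod p))) (M : Matrix (Fin n) (Fin n) (ZMod p)) :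
    ∑ D : Matrix (Fin n) (Fin n) (ZMod p),
        (Finset.univ.filter fun c : ZMod p => c ≠ 0 ∧ M + c • D ∈ S).card = (p - 1) * S.card := by
  have hsplit : ∀ D : Matrix (Fin n) (Fin n) (ZMod p),
      (Finset.univ.filter fun c : ZMod p => c ≠ 0 ∧ M + c • D ∈ S).card =
        ∑ c ∈ Finset.univ.filter (fun c : ZMod p => c ≠ 0), if M + c • D ∈ S then 1 else 0 := by
    intro D
    rw [Finset.card_filter, Finset.sum_filter]
    refine Finset.sum_congr rfl fun c _ => ?_
    by_cases hc : c = 0 <;> simp [hc]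
  calc ∑ D : Matrix (Fin n) (Fin n) (ZMod p),
        (Finset.univ.filter fun c : ZMod p => c ≠ 0 ∧ M + c • D ∈ S).card
      = ∑ D : Matrix (Fin n) (Fin n) (ZMod p), ∑ c ∈ Finset.univ.filter (fun c : ZMod p => c ≠ 0),
          (if M + c • D ∈ S then 1 else 0) := Finset.sum_congr rfl fun D _ => hsplit D
    _ = ∑ c ∈ Finset.univ.filter (fun c : ZMod p => c ≠ 0), ∑ D : Matrix (Fin n) (Fin n) (ZMod p),
          (if M + c • D ∈ S then 1 else 0) := Finset.sum_comm
    _ = ∑ c ∈ Finset.univ.filter (fun c : ZMod p => c ≠ 0), S.card := by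
        refine Finset.sum_congr rfl fun c hc => ?_
        simp only [Finset.sum_boole, Nat.cast_id]
        exact card_filter_line_eq p n S M (Finset.mem_filter.1 hc).2
    _ = (p - 1) * S.card := by rw [Finset.sum_const, smul_eq_mul, card_univ_filter_ne_zero]

/-! ## The stub -/

/-- **Stub H of line `Sketch` (hitting directions; combinatorics).** If a set `S` of `n × n`
matrices over `𝔽_p` has density `≥ 4(n+1)/p` (`4(n+1)·p^{n·n} ≤ p·#S`), then there is a list of at
most `p²n²` advice directions `D` such that through EVERY matrix `M` some listed line `M + c•D` meets
`S` in at least `n + 1` nonzero parameters `c`. Averaging over `D` (for fixed `M` a `≥ 1/p` fraction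
of the directions is good) + independent repetition of `p²n²` directions + a union bound over the
`p^{n·n}` targets; the non-uniform form of the line-sampling step of Lipton's random self-reduction
of the permanent. [cite: AroraBarakCC2009, §8.6.2] -/
theorem stub_hitting :
    ∀ (p n : ℕ) [Fact p.Prime] (S : Finset (Matrix (Fin n) (Fin n) (ZMod p))),
      2 ≤ n → n ^ 3 < p → 4 * (n + 1) * p ^ (n * n) ≤ p * S.card →
      ∃ dirs : List (Matrix (Fin n) (Fin n) (ZMod p)), dirs.length ≤ p ^ 2 * n ^ 2 ∧
        ∀ M : Matrix (Fin n) (Fin n) (ZMod p), ∃ D ∈ dirs,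
          n + 1 ≤ (Finset.univ.filter fun c : ZMod p => c ≠ 0 ∧ M + c • D ∈ S).card := by
  intro p n _ S hn _ hS
  have hp : 2 ≤ p := (Fact.out : p.Prime).two_le
  have hN : Fintype.card (Matrix (Fin n) (Fin n) (ZMod p)) = p ^ (n * n) := card_matrix p n
  -- Step 1 (averaging, reverse Markov): for every target `M`, `p · #bad(M) ≤ (p-1) · p^{n·n}`.
  have hbad : ∀ M : Matrix (Fin n) (Fin n) (ZMod p),
      p * (Finset.univ.filter fun D : Matrix (Fin n) (Fin n) (ZMod p) =>
        ¬n + 1 ≤ (Finset.univ.filter fun c : ZMod p => c ≠ 0 ∧ M + c • D ∈ S).card).card ≤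
        (p - 1) * Fintype.card (Matrix (Fin n) (Fin n) (ZMod p)) := by
    intro M
    have hle : ∀ D : Matrix (Fin n) (Fin n) (ZMod p),
        (Finset.univ.filter fun c : ZMod p => c ≠ 0 ∧ M + c • D ∈ S).card ≤ p - 1 := fun D =>
      calc (Finset.univ.filter fun c : ZMod p => c ≠ 0 ∧ M + c • D ∈ S).card
          ≤ (Finset.univ.filter fun c : ZMod p => c ≠ 0).card :=
            Finset.card_le_card fun c hc => by
              rw [Finset.mem_filter] at hc ⊢
              exact ⟨hc.1, hc.2.1⟩
        _ = p - 1 := card_univ_filter_ne_zero p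
    exact card_lt_threshold_le hp
      (fun D => (Finset.univ.filter fun c : ZMod p => c ≠ 0 ∧ M + c • D ∈ S).card)
      (sum_card_line_eq p n S M) hle (by rw [hN]; exact hS)
  -- Step 2 (repetition + union bound): a tuple of `p²n²` directions good for every target.
  obtain ⟨t, ht⟩ := exists_tuple_hitting (m := p ^ 2 * n ^ 2)
    (fun M : Matrix (Fin n) (Fin n) (ZMod p) =>
      Finset.univ.filter fun D : Matrix (Fin n) (Fin n) (ZMod p) =>
        ¬n + 1 ≤ (Finset.univ.filter fun c : ZMod p => c ≠ 0 ∧ M + c • D ∈ S).card)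
    hbad (by rw [hN]; exact key_numeric hp (by omega))
  refine ⟨List.ofFn t, by rw [List.length_ofFn], fun M => ?_⟩
  obtain ⟨i, hi⟩ := ht M
  refine ⟨t i, List.mem_ofFn.2 ⟨i, rfl⟩, ?_⟩
  by_contra h
  exact hi (Finset.mem_filter.2 ⟨Finset.mem_univ _, h⟩)

end Summit.PneNP.PneNP.Theorems.PermIsland
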